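import Summits.BirchSwinnertonDyer.BirchSwinnertonDyer.Theorems.KimAtThreeFineKatoKPortJunctionLog
import Mathlib.NumberTheory.Padics.ProperSpace
import HarnessLib

/-!
# K-PORT junction (J5): the DEGREE `[K_w : ℚ_p] = e·f`, the TWO-NORM dictionary `L_w ↔ K_w`,
# `ℚ_p`-linearity of continuous endomorphisms, `ProperSpace K_w`, and the norm-valued integer ring of `K_w`
# (cell `bsd-addord`, seat w2-kport gen 6; `--supports stmt-BirchSwinnertonDyer-19560`, helper)

HONEST FRAMING. Route W2 (`route-BirchSwinnertonDyer-KimAtThreeKolyvagin`), crux 19560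
`KatoKuriharaPortThreeShared`. kport's junction type `KPort.Kw p L w` (file `…KPortJunctionDefs`) is the
completion `L_w = w.1.adicCompletion L` of a number field `L` at a place `w ∣ p`, RE-NORMED with base `p`
(`‖x‖ = p^{v_w(x)}`, so `‖p‖ = p⁻¹` when `e(w∣p) = 1`) and given the `ℚ_[p]`-algebra structure
`(ℚ_v → L_w) ∘ e_p`; Mathlib's own norm on `L_w` (`NumberField.instNormedFieldValuedAdicCompletion`) has base
`N(w) = p^f`. Consumers that hold a statement in an ABSTRACT `p`-adic field
`K : [NormedAlgebra ℚ_[p] K] [IsUltrametricDist K] [ProperSpace K]` with `[K : ℚ_p] = f` (w2-acc3's Euler-lattice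
index `KimAtThreeEulerLatticeIndex.relIndex_integer_eulerLattice`, p521580) and want it AT `K := K_w` for objects
built on `L_w` with Mathlib's norm (w2-acc3's lattice lemma, `PadicLogEulerLatticeProofs`, STATUS 2026-08-27
10:44:47Z «kernel modulo one transport (D3)») need exactly the following junction facts, which this file proves
(TOOL theorems only; no definition, no instance, no named fact, no `sorry`; closes nothing by itself; nothing
booked; BSD / 19560 are not proved by any of this):

* §1 TWO NORMS, ONE ORDER (along the identity `Kw.toCompletion : K_w ≃+* L_w`): `norm_le_norm_iff_valued`
  (`‖x‖ ≤ ‖y‖ ↔ v_w x ≤ v_w y` on `K_w`), **`norm_toCompletion_le_iff`** / `norm_toCompletion_lt_iff` /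
  `norm_toCompletion_eq_iff` (`‖x‖_{L_w} ≤ ‖y‖_{L_w} ↔ ‖x‖_{K_w} ≤ ‖y‖_{K_w}`, etc.),
  `norm_toCompletion_le_one_iff` / `norm_toCompletion_lt_one_iff` / `norm_toCompletion_eq_one_iff`, and the
  ISOMETRY TRANSFER `forall_norm_map_eq_iff` (a self-map is `‖·‖_{L_w}`-isometric iff `‖·‖_{K_w}`-isometric).
* §2 THE NORM-VALUED INTEGER RING: `mem_integer_normedField_toValued_iff` — for the scoped instance
  `NormedField.toValued` (the `𝒪_K = Valued.integer K` of the abstract-`K` files, `open scoped NormedField`),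
  `x ∈ 𝒪[K_w] ↔ ‖x‖ ≤ 1` (`↔ x ∈ w.1.adicCompletionIntegers L`, `mem_integer_normedField_toValued_iff_mem_adicCompletionIntegers`).
* §3 DEGREE: `finrank_padic_completion` (`[ℚ_v : ℚ_p] = 1` along `e_p`), **`finrank_eq_finrank_completion`**
  (`[K_w : ℚ_p] = [L_w : ℚ_v]`), **`finrank_eq_ramificationIdx_mul_inertiaDeg`** (`[K_w : ℚ_p] = e(w∣p)·f(w∣p)`,
  the packet's `adicCompletion.ramificationIdx_mul_inertiaDeg_eq_finrank`), `finrank_eq_inertiaDeg` (`e = 1`),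
  `inertiaDeg_pos`, `finrank_pos`.
* §4 `ℚ_p`-LINEARITY OF CONTINUOUS RING ENDOMORPHISMS: `ringHom_map_algebraMap_of_continuous`
  (a continuous `φ : L_w →+* L_w` fixes `algebraMap ℚ_[p] K_w` — uniqueness of the continuous embedding
  `ℚ_p → L_w`, `LocalField.eq_algebraMap_adicCompletionPadicAlgebra` + kport's `algebraMap_adicCompletionPadicAlgebra_eq`),
  **`exists_algHom_of_continuous`** (`φ` IS a `ℚ_[p]`-algebra endomorphism `ψ` of `K_w`, `ψ = φ` pointwise), and
  the isometric version `exists_algHom_of_forall_norm_eq` (`‖φ x‖ = ‖x‖` on `L_w` ⇒ `ψ` with `‖ψ x‖ = ‖x‖` on `K_w`).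
* §5 COMPACTNESS: `locallyCompactSpace` and **`properSpace`** (`K_w` is a proper metric space — it is the
  local field `L_w`; no unramifiedness needed), as theorems (consumers `haveI`).
* §6 UNRAMIFIEDNESS TEST: `ramificationIdx_eq_one_of_forall_norm_lt_one`,
  `ramificationIdx_eq_one_iff_forall_norm_lt_one` (base-`p` norm) and
  **`ramificationIdx_eq_one_iff_forall_norm_completion_lt_one`** (Mathlib's norm on `L_w`): `e(w∣p) = 1 ↔
  (‖x‖ < 1 ⇒ ‖x‖ ≤ ‖p‖)` — turns the `hdisc` binder of the `w.adicCompletion L` files into the port's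
  `Fact (e(w∣p) = 1)` (whence `NormedAlgebra ℚ_[p] K_w`, `‖p‖ = p⁻¹`).

References: J.-P. Serre, *Local Fields* (1979), Ch. II §1–§3, §5 [SerreLocalFields1979]; J. W. S. Cassels,
A. Fröhlich, *Algebraic Number Theory* (1967), Ch. II §10 (`[L_w : K_v] = e f`) [CasselsFrohlichANT1967];
w2-acc3 HOME/w2acc3-g7/NOTES.md ## HANDOFF (D3 recipe).
-/

noncomputable section

-- the cell's Theorems namespace `Summit.BirchSwinnertonDyer.BirchSwinnertonDyer.…` repeats the summit name by design (D-0017)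
set_option linter.dupNamespace false

open scoped NNReal
open IsDedekindDomain NumberField WithZeroMulInt

namespace Summit.BirchSwinnertonDyer.BirchSwinnertonDyer.Theorems.KPort.Kw

variable {p : ℕ} [hp : Fact p.Prime] {L : Type} [Field L] [NumberField L]
  {w : ((Rat.HeightOneSpectrum.primesEquiv (R := 𝓞 ℚ)).symm ⟨p, hp.out⟩).Extension (𝓞 L)}

/-! ## §1 Two norms, one order: Mathlib's base-`N(w)` norm on `L_w` vs the base-`p` norm on `K_w` -/

/-- On `K_w`, `‖x‖ ≤ ‖y‖ ↔ v_w(x) ≤ v_w(y)` (`‖·‖ = p^{v_w}` is strictly monotone in the valuation).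
[cite: SerreLocalFields1979, Ch. II §1] -/
theorem norm_le_norm_iff_valued (x y : Kw p L w) :
    ‖x‖ ≤ ‖y‖ ↔ Valued.v x ≤ (Valued.v y : WithZero (Multiplicative ℤ)) := by
  rw [norm_def', norm_def', NNReal.coe_le_coe, (toNNReal_strictMono (one_lt_prime p)).le_iff_le]

/-- On `K_w`, `‖x‖ < ‖y‖ ↔ v_w(x) < v_w(y)`. [cite: SerreLocalFields1979, Ch. II §1] -/
theorem norm_lt_norm_iff_valued (x y : Kw p L w) :
    ‖x‖ < ‖y‖ ↔ Valued.v x < (Valued.v y : WithZero (Multiplicative ℤ)) := by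
  rw [norm_def', norm_def', NNReal.coe_lt_coe, (toNNReal_strictMono (one_lt_prime p)).lt_iff_lt]

/-- On `L_w` with Mathlib's norm (base `N(w)`), `‖x‖ ≤ ‖y‖ ↔ v_w(x) ≤ v_w(y)`, read on `K_w` along the
identity `toCompletion`. [cite: SerreLocalFields1979, Ch. II §1] -/
theorem norm_toCompletion_le_iff_valued (x y : Kw p L w) :
    ‖toCompletion p L w x‖ ≤ ‖toCompletion p L w y‖ ↔
      Valued.v x ≤ (Valued.v y : WithZero (Multiplicative ℤ)) := by
  rw [NumberField.FinitePlace.norm_def w.1 (toCompletion p L w x),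
    NumberField.FinitePlace.norm_def w.1 (toCompletion p L w y), NNReal.coe_le_coe,
    (toNNReal_strictMono (NumberField.HeightOneSpectrum.one_lt_absNorm_nnreal w.1)).le_iff_le,
    valued_toCompletion, valued_toCompletion]

/-- On `L_w` with Mathlib's norm, `‖x‖ < ‖y‖ ↔ v_w(x) < v_w(y)`, read on `K_w`. [cite: SerreLocalFields1979, Ch. II §1] -/
theorem norm_toCompletion_lt_iff_valued (x y : Kw p L w) :
    ‖toCompletion p L w x‖ < ‖toCompletion p L w y‖ ↔
      Valued.v x < (Valued.v y : WithZero (Multiplicative ℤ)) := by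
  rw [NumberField.FinitePlace.norm_def w.1 (toCompletion p L w x),
    NumberField.FinitePlace.norm_def w.1 (toCompletion p L w y), NNReal.coe_lt_coe,
    (toNNReal_strictMono (NumberField.HeightOneSpectrum.one_lt_absNorm_nnreal w.1)).lt_iff_lt,
    valued_toCompletion, valued_toCompletion]

/-- **Two norms, one order**: `‖x‖_{L_w} ≤ ‖y‖_{L_w} ↔ ‖x‖_{K_w} ≤ ‖y‖_{K_w}` (both norms are
`c^{v_w}` for `c = N(w)` resp. `c = p`). [cite: SerreLocalFields1979, Ch. II §1] -/
theorem norm_toCompletion_le_iff (x y : Kw p L w) :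
    ‖toCompletion p L w x‖ ≤ ‖toCompletion p L w y‖ ↔ ‖x‖ ≤ ‖y‖ := by
  rw [norm_toCompletion_le_iff_valued, norm_le_norm_iff_valued]

/-- `‖x‖_{L_w} < ‖y‖_{L_w} ↔ ‖x‖_{K_w} < ‖y‖_{K_w}`. [cite: SerreLocalFields1979, Ch. II §1] -/
theorem norm_toCompletion_lt_iff (x y : Kw p L w) :
    ‖toCompletion p L w x‖ < ‖toCompletion p L w y‖ ↔ ‖x‖ < ‖y‖ := by
  rw [norm_toCompletion_lt_iff_valued, norm_lt_norm_iff_valued]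

/-- `‖x‖_{L_w} = ‖y‖_{L_w} ↔ ‖x‖_{K_w} = ‖y‖_{K_w}`. [cite: SerreLocalFields1979, Ch. II §1] -/
theorem norm_toCompletion_eq_iff (x y : Kw p L w) :
    ‖toCompletion p L w x‖ = ‖toCompletion p L w y‖ ↔ ‖x‖ = ‖y‖ := by
  rw [le_antisymm_iff, le_antisymm_iff, norm_toCompletion_le_iff, norm_toCompletion_le_iff]

/-- `‖x‖_{L_w} ≤ 1 ↔ ‖x‖_{K_w} ≤ 1` (the common unit ball `𝒪_w`, (J1)). [cite: SerreLocalFields1979, Ch. II §1] -/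
theorem norm_toCompletion_le_one_iff (x : Kw p L w) : ‖toCompletion p L w x‖ ≤ 1 ↔ ‖x‖ ≤ 1 := by
  have h := norm_toCompletion_le_iff x 1
  rwa [map_one, norm_one, norm_one] at h

/-- `‖x‖_{L_w} < 1 ↔ ‖x‖_{K_w} < 1` (the common maximal ideal `𝔪_w`). [cite: SerreLocalFields1979, Ch. II §1] -/
theorem norm_toCompletion_lt_one_iff (x : Kw p L w) : ‖toCompletion p L w x‖ < 1 ↔ ‖x‖ < 1 := by
  have h := norm_toCompletion_lt_iff x 1
  rwa [map_one, norm_one, norm_one] at h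

/-- `‖x‖_{L_w} = 1 ↔ ‖x‖_{K_w} = 1` (the common unit group `𝒪_wˣ`). [cite: SerreLocalFields1979, Ch. II §1] -/
theorem norm_toCompletion_eq_one_iff (x : Kw p L w) : ‖toCompletion p L w x‖ = 1 ↔ ‖x‖ = 1 := by
  have h := norm_toCompletion_eq_iff x 1
  rwa [map_one, norm_one, norm_one] at h

/-- **Isometry transfer**: a self-map of `L_w = K_w` preserves Mathlib's norm of `L_w` iff it preserves
the base-`p` norm of `K_w` (for the Frobenius `φ` of an abstract-`K` statement instantiated at `K_w`).
[cite: SerreLocalFields1979, Ch. II §1] -/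
theorem forall_norm_map_eq_iff (φ : Kw p L w → Kw p L w) :
    (∀ x, ‖toCompletion p L w (φ x)‖ = ‖toCompletion p L w x‖) ↔ ∀ x, ‖φ x‖ = ‖x‖ :=
  forall_congr' fun x => norm_toCompletion_eq_iff (φ x) x

/-- A set cut out by a norm inequality `‖T x‖ ≤ ‖c‖` is the same set for the two norms (e.g. a lattice
`{y : ‖T y‖ ≤ 1}` or `{y : ‖T y‖ ≤ ‖p‖}` built on `L_w` is the one built on `K_w`). [cite: SerreLocalFields1979, Ch. II §1] -/
theorem setOf_norm_map_le_eq (T : Kw p L w → Kw p L w) (c : Kw p L w) :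
    {y : Kw p L w | ‖toCompletion p L w (T y)‖ ≤ ‖toCompletion p L w c‖} = {y : Kw p L w | ‖T y‖ ≤ ‖c‖} :=
  Set.ext fun y => norm_toCompletion_le_iff (T y) c

/-! ## §2 The norm-valued integer ring of `K_w` (scoped instance `NormedField.toValued`) -/

/-- **`𝒪[K_w] = {‖x‖ ≤ 1}` for the NORM-VALUED structure**: with the scoped instance `NormedField.toValued`
(`open scoped NormedField`; the `Valued.integer K` of the abstract-`K` files such as
`KimAtThreeEulerLatticeIndex` / `Literature.IUT.LogVolume.IntegerRingFinite`), membership in the valuation ring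
of `K_w` is `‖x‖ ≤ 1`.  (Stated with the instance given explicitly: `K_w` also carries its `ℤᵐ⁰`-valued
`Kw.instValued`, and `Valued`'s value group is an `outParam`.) [folklore] -/
theorem mem_integer_normedField_toValued_iff (x : Kw p L w) :
    x ∈ @Valued.integer (Kw p L w) _ ℝ≥0 _ NormedField.toValued ↔ ‖x‖ ≤ 1 := by
  rw [Valued.integer, Valuation.mem_integer_iff]
  change ‖x‖₊ ≤ 1 ↔ _
  rw [← NNReal.coe_le_coe, coe_nnnorm, NNReal.coe_one]

/-- The norm-valued integer ring of `K_w` is `𝒪_w = w.1.adicCompletionIntegers L` ((J1) in the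
`Valued.integer` spelling). [cite: SerreLocalFields1979, Ch. II §1] -/
theorem mem_integer_normedField_toValued_iff_mem_adicCompletionIntegers (x : Kw p L w) :
    x ∈ @Valued.integer (Kw p L w) _ ℝ≥0 _ NormedField.toValued ↔
      toCompletion p L w x ∈ w.1.adicCompletionIntegers L := by
  rw [mem_integer_normedField_toValued_iff, ← mem_unitBall_iff_mem_adicCompletionIntegers,
    Literature.NumberTheory.GaloisRepresentations.LubinTate.mem_unitBall_iff]

/-- The norm-valued integer ring of `K_w` and the `ℤᵐ⁰`-valued one (`Kw.instValued`) have the same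
elements. [folklore] -/
theorem mem_integer_normedField_toValued_iff_valued_le_one (x : Kw p L w) :
    x ∈ @Valued.integer (Kw p L w) _ ℝ≥0 _ NormedField.toValued ↔
      Valued.v x ≤ (1 : WithZero (Multiplicative ℤ)) := by
  rw [mem_integer_normedField_toValued_iff, norm_le_one_iff]

/-! ## §3 The degree `[K_w : ℚ_p] = e(w∣p) · f(w∣p)` -/

section Degree

variable (p L w)

/-- **`[ℚ_v : ℚ_p] = 1`** for the `ℚ_[p]`-module structure of `ℚ_v = v.adicCompletion ℚ` along
`e_p = Padic.adicCompletionEquiv (𝓞 ℚ) p` (a ring ISOMORPHISM, hence a `ℚ_[p]`-linear equivalence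
`ℚ_[p] ≃ ℚ_v`). [folklore] -/
theorem finrank_padic_completion :
    letI : Algebra ℚ_[p] (((Rat.HeightOneSpectrum.primesEquiv (R := 𝓞 ℚ)).symm ⟨p, hp.out⟩).adicCompletion ℚ) :=
      (Padic.adicCompletionEquiv (𝓞 ℚ) ⟨p, hp.out⟩).toRingEquiv.toRingHom.toAlgebra
    Module.finrank ℚ_[p] (((Rat.HeightOneSpectrum.primesEquiv (R := 𝓞 ℚ)).symm ⟨p, hp.out⟩).adicCompletion ℚ) = 1 := by
  letI : Algebra ℚ_[p] (((Rat.HeightOneSpectrum.primesEquiv (R := 𝓞 ℚ)).symm ⟨p, hp.out⟩).adicCompletion ℚ) :=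
    (Padic.adicCompletionEquiv (𝓞 ℚ) ⟨p, hp.out⟩).toRingEquiv.toRingHom.toAlgebra
  -- `e_p` as a `ℚ_[p]`-linear equivalence (linearity = multiplicativity of `e_p`)
  let e : ℚ_[p] ≃ₗ[ℚ_[p]] (((Rat.HeightOneSpectrum.primesEquiv (R := 𝓞 ℚ)).symm ⟨p, hp.out⟩).adicCompletion ℚ) :=
    { (Padic.adicCompletionEquiv (𝓞 ℚ) ⟨p, hp.out⟩).toRingEquiv.toAddEquiv with
      map_smul' := fun r s => by
        change Padic.adicCompletionEquiv (𝓞 ℚ) ⟨p, hp.out⟩ (r * s) =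
          Padic.adicCompletionEquiv (𝓞 ℚ) ⟨p, hp.out⟩ r * Padic.adicCompletionEquiv (𝓞 ℚ) ⟨p, hp.out⟩ s
        exact map_mul _ r s }
  rw [← e.finrank_eq, Module.finrank_self]

/-- **`[K_w : ℚ_p] = [L_w : ℚ_v]`**: the `ℚ_[p]`-degree of kport's `K_w` is the packet degree of `L_w`
over `ℚ_v` (tower `ℚ_[p] → ℚ_v → L_w` with `[ℚ_v : ℚ_p] = 1`). [cite: CasselsFrohlichANT1967, Ch. II §10] -/
theorem finrank_eq_finrank_completion :
    Module.finrank ℚ_[p] (Kw p L w) =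
      Module.finrank (((Rat.HeightOneSpectrum.primesEquiv (R := 𝓞 ℚ)).symm ⟨p, hp.out⟩).adicCompletion ℚ)
        (w.1.adicCompletion L) := by
  letI : Algebra ℚ_[p] (((Rat.HeightOneSpectrum.primesEquiv (R := 𝓞 ℚ)).symm ⟨p, hp.out⟩).adicCompletion ℚ) :=
    (Padic.adicCompletionEquiv (𝓞 ℚ) ⟨p, hp.out⟩).toRingEquiv.toRingHom.toAlgebra
  haveI : IsScalarTower ℚ_[p] (((Rat.HeightOneSpectrum.primesEquiv (R := 𝓞 ℚ)).symm ⟨p, hp.out⟩).adicCompletion ℚ)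
      (Kw p L w) := IsScalarTower.of_algebraMap_eq fun r => rfl
  have h := Module.finrank_mul_finrank ℚ_[p]
    (((Rat.HeightOneSpectrum.primesEquiv (R := 𝓞 ℚ)).symm ⟨p, hp.out⟩).adicCompletion ℚ) (Kw p L w)
  rw [finrank_padic_completion, one_mul] at h
  exact h.symm

/-- **`[K_w : ℚ_p] = e(w∣p) · f(w∣p)`** (ramification index times residue degree of the place `w` of `L`
over `p`; the packet's `adicCompletion.ramificationIdx_mul_inertiaDeg_eq_finrank`).
[cite: CasselsFrohlichANT1967, Ch. II §10] -/
theorem finrank_eq_ramificationIdx_mul_inertiaDeg :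
    Module.finrank ℚ_[p] (Kw p L w) =
      w.1.asIdeal.ramificationIdx (𝓞 ℚ) * w.1.asIdeal.inertiaDeg (𝓞 ℚ) := by
  rw [finrank_eq_finrank_completion,
    IsDedekindDomain.HeightOneSpectrum.adicCompletion.ramificationIdx_mul_inertiaDeg_eq_finrank ℚ L w]

/-- **`[K_w : ℚ_p] = f(w∣p)` for `w` unramified over `p`** (the `hf : Module.finrank ℚ_[p] K = f` of the
abstract-`K` statements, at `K := K_w`). [cite: CasselsFrohlichANT1967, Ch. II §10] -/
theorem finrank_eq_inertiaDeg (he : w.1.asIdeal.ramificationIdx (𝓞 ℚ) = 1) :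
    Module.finrank ℚ_[p] (Kw p L w) = w.1.asIdeal.inertiaDeg (𝓞 ℚ) := by
  rw [finrank_eq_ramificationIdx_mul_inertiaDeg, he, one_mul]

/-- `[K_w : ℚ_p] = f(w∣p)` under the port's standing `Fact (e(w∣p) = 1)`. [cite: CasselsFrohlichANT1967, Ch. II §10] -/
theorem finrank_eq_inertiaDeg' [he : Fact (w.1.asIdeal.ramificationIdx (𝓞 ℚ) = 1)] :
    Module.finrank ℚ_[p] (Kw p L w) = w.1.asIdeal.inertiaDeg (𝓞 ℚ) :=
  finrank_eq_inertiaDeg p L w he.out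

/-- The residue degree `f(w∣p)` is positive. [folklore] -/
theorem inertiaDeg_pos : 0 < w.1.asIdeal.inertiaDeg (𝓞 ℚ) :=
  Ideal.inertiaDeg_pos _ _

/-- `0 < [K_w : ℚ_p]`. [folklore] -/
theorem finrank_pos : 0 < Module.finrank ℚ_[p] (Kw p L w) :=
  Module.finrank_pos

end Degree

/-! ## §4 Continuous ring endomorphisms of `L_w` are `ℚ_p`-linear on `K_w` -/

/-- The identity `toCompletion : K_w → L_w` is continuous (same topology). [folklore] -/
theorem continuous_toCompletion : Continuous (toCompletion p L w) := continuous_id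

/-- The identity `toCompletion.symm : L_w → K_w` is continuous (same topology). [folklore] -/
theorem continuous_toCompletion_symm : Continuous (toCompletion p L w).symm := continuous_id

/-- **A continuous ring endomorphism of `L_w` fixes `ℚ_p`**: for `φ : L_w →+* L_w` continuous and
`r : ℚ_[p]`, `φ (algebraMap ℚ_[p] K_w r) = algebraMap ℚ_[p] K_w r` — both `φ ∘ algebraMap` and `algebraMap`
are continuous ring maps `ℚ_p → L_w`, and there is only one (`LocalField.eq_algebraMap_adicCompletionPadicAlgebra`).
[cite: SerreLocalFields1979, Ch. II §5] -/
theorem ringHom_map_algebraMap_of_continuous (φ : w.1.adicCompletion L →+* w.1.adicCompletion L)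
    (hφ : Continuous φ) (r : ℚ_[p]) :
    φ (toCompletion p L w (algebraMap ℚ_[p] (Kw p L w) r)) = toCompletion p L w (algebraMap ℚ_[p] (Kw p L w) r) := by
  have hw : ((p : ℕ) : 𝓞 L) ∈ w.1.asIdeal := prime_mem_asIdeal (p := p) (L := L) (w := w)
  -- kport's `algebraMap ℚ_[p] K_w`, read in `L_w`, as a ring map `ℚ_[p] →+* L_w`
  set ι : ℚ_[p] →+* w.1.adicCompletion L :=
    (toCompletion p L w).toRingHom.comp (algebraMap ℚ_[p] (Kw p L w)) with hι
  have hιc : Continuous ι := (continuous_toCompletion (p := p) (L := L) (w := w)).comp (continuous_algebraMap_padic w)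
  have h1 := Literature.NumberTheory.GaloisRepresentations.LocalField.eq_algebraMap_adicCompletionPadicAlgebra
    w.1 p hw ι hιc
  have h2 := Literature.NumberTheory.GaloisRepresentations.LocalField.eq_algebraMap_adicCompletionPadicAlgebra
    w.1 p hw (φ.comp ι) (hφ.comp hιc)
  have h3 : φ.comp ι = ι := h2.trans h1.symm
  exact (RingHom.congr_fun h3 r : _)

/-- **A continuous ring endomorphism of `L_w` IS a `ℚ_[p]`-algebra endomorphism of `K_w`** (same
underlying map). [cite: SerreLocalFields1979, Ch. II §5] -/
theorem exists_algHom_of_continuous (φ : w.1.adicCompletion L →+* w.1.adicCompletion L) (hφ : Continuous φ) :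
    ∃ ψ : Kw p L w →ₐ[ℚ_[p]] Kw p L w, ∀ x, toCompletion p L w (ψ x) = φ (toCompletion p L w x) :=
  ⟨{ ((toCompletion p L w).toRingHom.comp φ).comp (toCompletion p L w).toRingHom with
      commutes' := fun r => ringHom_map_algebraMap_of_continuous φ hφ r }, fun _ => rfl⟩

/-- An isometric (for Mathlib's norm) ring endomorphism of `L_w` is continuous. [folklore] -/
theorem continuous_of_forall_norm_eq (φ : w.1.adicCompletion L →+* w.1.adicCompletion L)
    (hφ : ∀ x, ‖φ x‖ = ‖x‖) : Continuous φ :=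
  (AddMonoidHomClass.isometry_of_norm φ hφ).continuous

/-- **The isometric Frobenius package at `K := K_w`**: a ring endomorphism `φ` of `L_w` with `‖φ x‖ = ‖x‖`
(Mathlib's norm) is a `ℚ_[p]`-algebra endomorphism `ψ` of `K_w` with `‖ψ x‖ = ‖x‖` (base-`p` norm) and
`ψ = φ` pointwise — the `(φ : K →ₐ[ℚ_[p]] K) (hφ : ∀ x, ‖φ x‖ = ‖x‖)` binders of the abstract-`K` statements.
[cite: SerreLocalFields1979, Ch. II §1, §5] -/
theorem exists_algHom_of_forall_norm_eq (φ : w.1.adicCompletion L →+* w.1.adicCompletion L)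
    (hφ : ∀ x, ‖φ x‖ = ‖x‖) :
    ∃ ψ : Kw p L w →ₐ[ℚ_[p]] Kw p L w,
      (∀ x, toCompletion p L w (ψ x) = φ (toCompletion p L w x)) ∧ ∀ x, ‖ψ x‖ = ‖x‖ := by
  obtain ⟨ψ, hψ⟩ := exists_algHom_of_continuous φ (continuous_of_forall_norm_eq φ hφ)
  refine ⟨ψ, hψ, (forall_norm_map_eq_iff (p := p) (L := L) (w := w) ψ).mp fun x => ?_⟩
  rw [hψ x, hφ]

/-- Powers of the transported endomorphism are the transported powers: `ψ^n = φ^n` pointwise. [folklore] -/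
theorem algHom_pow_apply_eq {φ : w.1.adicCompletion L →+* w.1.adicCompletion L} {ψ : Kw p L w →ₐ[ℚ_[p]] Kw p L w}
    (hψ : ∀ x, toCompletion p L w (ψ x) = φ (toCompletion p L w x)) (n : ℕ) (x : Kw p L w) :
    toCompletion p L w ((ψ ^ n) x) = (φ ^ n) (toCompletion p L w x) := by
  induction n generalizing x with
  | zero => rfl
  | succ n ih => rw [pow_succ, pow_succ, AlgHom.mul_apply, RingHom.coe_mul, Function.comp_apply, ih, hψ]

/-! ## §5 `K_w` is locally compact and proper -/

section Compact

variable (p L w)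

/-- `K_w` is locally compact (it is the local field `L_w`; same topology). [cite: SerreLocalFields1979, Ch. II §1] -/
theorem locallyCompactSpace : LocallyCompactSpace (Kw p L w) :=
  inferInstanceAs (LocallyCompactSpace (w.1.adicCompletion L))

/-- **`K_w` is a proper metric space** (a locally compact nontrivially normed field is proper) — the
`[ProperSpace K]` binder of the abstract-`K` statements at `K := K_w`; no unramifiedness needed.
[cite: SerreLocalFields1979, Ch. II §1] -/
theorem properSpace : ProperSpace (Kw p L w) :=
  haveI := locallyCompactSpace p L w
  ProperSpace.of_nontriviallyNormedField_of_weaklyLocallyCompactSpace (Kw p L w)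

end Compact

/-! ## §6 Unramifiedness `e(w∣p) = 1` ↔ the port's `hK` («`‖x‖ < 1 ⇒ ‖x‖ ≤ ‖p‖`»), in either norm -/

/-- `e(w∣p) ≠ 0`. [folklore] -/
theorem ramificationIdx_ne_zero : w.1.asIdeal.ramificationIdx (𝓞 ℚ) ≠ 0 :=
  IsDedekindDomain.HeightOneSpectrum.ramificationIdx_ne_zero (𝓞 ℚ) (𝓞 L)
    (algebraMap_injective_of_field_isFractionRing (𝓞 ℚ) (𝓞 L) ℚ L) w.1

/-- **`hK` forces `e(w∣p) = 1`**: if every `x ∈ K_w` with `‖x‖ < 1` has `‖x‖ ≤ ‖p‖` (base-`p` norm), then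
`w` is unramified over `p` (a uniformizer `π` has `v_w(π) = exp(−1) ≤ v_w(p) = exp(−e)`).  Converse:
`Kw.norm_le_norm_prime_of_norm_lt_one`. [cite: SerreLocalFields1979, Ch. II §1] -/
theorem ramificationIdx_eq_one_of_forall_norm_lt_one
    (h : ∀ x : Kw p L w, ‖x‖ < 1 → ‖x‖ ≤ ‖((p : ℕ) : Kw p L w)‖) :
    w.1.asIdeal.ramificationIdx (𝓞 ℚ) = 1 := by
  obtain ⟨π, hπ⟩ := valued_surjective (p := p) (L := L) (w := w) (WithZero.exp (-1 : ℤ))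
  have hπ1 : ‖π‖ < 1 := by
    rw [norm_lt_one_iff, hπ, ← WithZero.exp_zero, WithZero.exp_lt_exp]
    norm_num
  have hle := (norm_le_norm_iff_valued π _).mp (h π hπ1)
  rw [hπ, valued_natCast_prime, WithZero.exp_le_exp] at hle
  have he0 := ramificationIdx_ne_zero (p := p) (L := L) (w := w)
  omega

/-- **`e(w∣p) = 1 ↔ hK` on `K_w`** (base-`p` norm). [cite: SerreLocalFields1979, Ch. II §1] -/
theorem ramificationIdx_eq_one_iff_forall_norm_lt_one :
    w.1.asIdeal.ramificationIdx (𝓞 ℚ) = 1 ↔ ∀ x : Kw p L w, ‖x‖ < 1 → ‖x‖ ≤ ‖((p : ℕ) : Kw p L w)‖ :=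
  ⟨fun he x hx => norm_le_norm_prime_of_norm_lt_one he x hx, ramificationIdx_eq_one_of_forall_norm_lt_one⟩

/-- **`e(w∣p) = 1 ↔ hK` on `L_w` with Mathlib's norm** (the `hdisc : ‖x‖ < 1 → ‖x‖ ≤ ‖p‖` binder of the
`w.adicCompletion L` files, e.g. `EulerLattice.norm_frobeniusCombination_padicLog_le`): so a consumer holding
`hdisc` obtains the port's `Fact (e(w∣p) = 1)` (`⟨(…).mpr hdisc⟩`), hence `NormedAlgebra ℚ_[p] K_w`.
[cite: SerreLocalFields1979, Ch. II §1] -/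
theorem ramificationIdx_eq_one_iff_forall_norm_completion_lt_one :
    w.1.asIdeal.ramificationIdx (𝓞 ℚ) = 1 ↔
      ∀ x : w.1.adicCompletion L, ‖x‖ < 1 → ‖x‖ ≤ ‖((p : ℕ) : w.1.adicCompletion L)‖ := by
  rw [ramificationIdx_eq_one_iff_forall_norm_lt_one]
  have hp' : toCompletion p L w ((p : ℕ) : Kw p L w) = ((p : ℕ) : w.1.adicCompletion L) := map_natCast _ p
  constructor
  · intro h x hx
    have hx' : ‖(toCompletion p L w).symm x‖ < 1 := by
      rw [← norm_toCompletion_lt_one_iff, RingEquiv.apply_symm_apply]; exact hx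
    have h1 := h _ hx'
    rw [← norm_toCompletion_le_iff, RingEquiv.apply_symm_apply, hp'] at h1
    exact h1
  · intro h x hx
    have hx' : ‖toCompletion p L w x‖ < 1 := (norm_toCompletion_lt_one_iff x).mpr hx
    have h1 := h _ hx'
    rw [← hp', norm_toCompletion_le_iff] at h1
    exact h1

end Summit.BirchSwinnertonDyer.BirchSwinnertonDyer.Theorems.KPort.Kw

end
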